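import Summits.QuantumFields.BalabanUV.T4Continuum.Support.DirichletMonotoneCutoff

/-!
# `BalabanUV.T4Continuum.Support.DirichletMonotoneCutoffBounds` — NE2 (node U1a) formalisation swarm, SUPPLIER item «Δ1-BESOV» under
# the owner's sub-row `T4-U1a.S-NE2-D1-DIRICHLET°` (wall `hinj`): module (II) file 2 of 2 — THE DIFFERENCE BOUNDS OF THE VERTEX BUMPS,
# LOCALLY MONOTONE BLOCK SETS, AND THE END `admissibleCutoff_psi` (unit b2b-balaban-t4-ne2-formalise-leaf-08, gen 3, v1)

HONEST FRAMING.  Rung (B)+1 bookkeeping at MODEL level, finite torus; pure lattice combinatorics ∕ real polynomial inequalities; NE2 (U1a)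
is NOT proved by this file; spine PROVED 0/9 unchanged; NOT infinite volume, NOT the mass gap, NOT Clay.  HONEST DEPENDENCY (verbatim):
«continuum YM on T⁴ ⇐ BetaPertH ∧ nine spine estimates (0/9 proved); BetaPertH ⇐ (D1) ∧ (D4) ∧ CAP+tail; G-an2-4 gates asym, D1 and
NE2/3/4.»

File 1 (`DirichletMonotoneCutoff`) built the vertex bumps `bump v x` (cubic-smoothstep products, an exact partition of unity) and
the block/offset translation lemmas.  THIS FILE proves (0 sorry): §4 **`sum_abs_bump_sub_le`** (`Σ_v |bump v (x + e_μ) − bump v x|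
≤ 3/(n−1)`) and **`sum_abs_bump_second_le`** (`Σ_v |2·bump v x − bump v (x+e_μ) − bump v (x−e_μ)| ≤ 12/(n−1)²`) — the vertex sum
FACTORISES axis by axis (`sum_prod_ite_eq`), leaving at most two ramp differences (interior ∕ first-layer ∕ last-layer cases); §5
[shape] `InPatch`, `DownClosed`, `UpClosed`, **`LocallyMonotone S`** (every vertex patch downward- OR upward-closed along every axis),
the cutoff **`psi S μ = Σ_{v downward-closed along μ} bump v`** (values in `[0,1]`, differences as in §4, `ψ = 0` where the
`−μ`-neighbour leaves the region, `ψ = 1` where the `+μ`-neighbour leaves — by local monotonicity) and THE END **`admissibleCutoff_psi`**: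
`2 ≤ n → LocallyMonotone S → AdmissibleCutoff (fine n M) (blockReg n M S) μ (psi S μ) (3/(n−1)) (12/(n−1)²)`, plus the unit-scale
corollary **`exists_admissibleCutoff`** (`ℓ₁ = 6/n`, `ℓ₂ = 48/n²`) consumed by module (III).  Located (prose): the checkerboard pair at
a vertex and the face-connected 4-chain of cubes winding around a vertex (d ≥ 3) are NOT locally monotone.

ABSOLUTE RULE (cell, verbatim): «No internally-minted statement may enter as a cited fact. Every hypothesis is either kernel-proved in
this package or a verbatim quotation of a PUBLISHED theorem with page reference. The manuscript(s) under audit are NOT citable for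
their own disputed steps — they are the thing under adjudication; programme-internal (2001/route/tribunal) claims are never citable.»
[folklore] throughout; parametrised shape predicates and data defs only; no `def … : Prop` fact.  NOT CLAIMED: non-monotone regions;
NE2; NE3; «not in print; our construction».
-/

noncomputable section

open scoped BigOperators
open Finset

namespace Summit.QuantumFields.BalabanUV.T4Continuum.DirichletMonotoneCutoff

open Literature.MathematicalPhysics.QuantumFieldTheory.Balaban1983to89.B5Prop11Plancherel (Tor fine unitVec)
open Literature.MathematicalPhysics.QuantumFieldTheory.Balaban1983to89.B5Block118 (bpt)
open Literature.MathematicalPhysics.QuantumFieldTheory.Balaban1983to89.B5Blocks16 (blockOf)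
open Summit.QuantumFields.BalabanUV.T4Continuum.DirichletDirectionalBesovCutoff (AdmissibleCutoff)
open Summit.QuantumFields.BalabanUV.Beta.GAN24.DirichletBoxTrace (blockReg)

variable {d : ℕ}
/-! ## §4 First and pure second differences of the bumps, summed over the vertices -/

section Differences

variable (n : ℕ) [NeZero n] (M : Fin d → ℕ) [hM : ∀ μ, NeZero (M μ)]

/-- the FACTORISATION of a vertex sum with one distinguished axis:
`Σ_v Π_ν (if ν = μ then G_ν (v ν) else F_ν (v ν)) = Σ_c G_μ c` whenever `Σ_c F_ν c = 1` for `ν ≠ μ`. [folklore] -/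
theorem sum_prod_ite_eq (μ : Fin d) (F G : (ν : Fin d) → ZMod (M ν) → ℝ) (hF : ∀ ν, ν ≠ μ → ∑ c : ZMod (M ν), F ν c = 1) :
    ∑ v : Tor M, (∏ ν, if ν = μ then G ν (v ν) else F ν (v ν)) = ∑ c : ZMod (M μ), G μ c := by
  rw [← Fintype.piFinset_univ, ← Finset.prod_univ_sum (fun _ => Finset.univ)
    (fun ν (c : ZMod (M ν)) => if ν = μ then G ν c else F ν c), ← Finset.mul_prod_erase _ _ (Finset.mem_univ μ)]
  have h1 : (∑ c : ZMod (M μ), if μ = μ then G μ c else F μ c) = ∑ c, G μ c :=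
    Finset.sum_congr rfl fun c _ => by rw [if_pos rfl]
  have h2 : ∏ ν ∈ Finset.univ.erase μ, (∑ c : ZMod (M ν), if ν = μ then G ν c else F ν c) = 1 :=
    Finset.prod_eq_one fun ν hν => by
      rw [Finset.mem_erase] at hν
      rw [← hF ν hν.1]
      exact Finset.sum_congr rfl fun c _ => by rw [if_neg hν.1]
  rw [h1, h2, mul_one]

/-- **generic comparison lemma**: if two sites `x, y` have the same blocks and offsets off the axis `μ`, then for any real
combination `Φ` of the `μ`-factors that is homogeneous under a common nonnegative factor,
`Σ_v |Φ(bumps)| ≤ Σ_c |Φ(axis factors at c)|` — here in the concrete form needed: for weights `α β γ` and three sites `x y z`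
agreeing off `μ`, `Σ_v |α·bump v x + β·bump v y + γ·bump v z| ≤ Σ_c |α·θ_c(x) + β·θ_c(y) + γ·θ_c(z)|`. [folklore] -/
theorem sum_abs_combo_le (hn : 2 ≤ n) (μ : Fin d) (α β γ : ℝ) (x y z : Tor (fine n M))
    (hbxy : ∀ ν, ν ≠ μ → blockOf n M y ν = blockOf n M x ν) (hoxy : ∀ ν, ν ≠ μ → offsF n M y ν = offsF n M x ν)
    (hbxz : ∀ ν, ν ≠ μ → blockOf n M z ν = blockOf n M x ν) (hoxz : ∀ ν, ν ≠ μ → offsF n M z ν = offsF n M x ν) :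
    ∑ v : Tor M, |α * bump n M v x + β * bump n M v y + γ * bump n M v z|
      ≤ ∑ c : ZMod (M μ), |α * axisF n c (blockOf n M x μ) (offsF n M x μ : ℕ) + β * axisF n c (blockOf n M y μ) (offsF n M y μ : ℕ)
          + γ * axisF n c (blockOf n M z μ) (offsF n M z μ : ℕ)| := by
  -- the common off-axis product `P(v) = Π_{ν≠μ} θ_ν(v ν; x) ∈ [0,1]` and `Σ_v P(v)·|combo(v μ)| = Σ_c |combo c|`
  set F : (ν : Fin d) → ZMod (M ν) → ℝ := fun ν c => axisF n c (blockOf n M x ν) (offsF n M x ν : ℕ) with hF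
  set G : (ν : Fin d) → ZMod (M ν) → ℝ := fun ν c => |α * axisF n c (blockOf n M x ν) (offsF n M x ν : ℕ)
      + β * axisF n c (blockOf n M y ν) (offsF n M y ν : ℕ) + γ * axisF n c (blockOf n M z ν) (offsF n M z ν : ℕ)| with hG
  have hsum := sum_prod_ite_eq M μ F G (fun ν _ => sum_axisF n _ _)
  rw [← hsum]
  refine Finset.sum_le_sum fun v _ => ?_
  -- `|α bx + β by + γ bz| = P(v)·|α θx + β θy + γ θz| ≤` the `dite` product (which IS `P(v)·G(v μ)`)
  have hP0 : 0 ≤ ∏ ν ∈ Finset.univ.erase μ, F ν (v ν) :=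
    Finset.prod_nonneg fun ν _ => (axisF_mem n hn _ _ (offsF n M x ν).isLt).1
  have hx : bump n M v x = (∏ ν ∈ Finset.univ.erase μ, F ν (v ν)) * axisF n (v μ) (blockOf n M x μ) (offsF n M x μ : ℕ) := by
    rw [bump, ← Finset.mul_prod_erase _ _ (Finset.mem_univ μ), mul_comm]
  have hy : bump n M v y = (∏ ν ∈ Finset.univ.erase μ, F ν (v ν)) * axisF n (v μ) (blockOf n M y μ) (offsF n M y μ : ℕ) := by
    rw [bump, ← Finset.mul_prod_erase _ _ (Finset.mem_univ μ), mul_comm]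
    congr 1
    exact Finset.prod_congr rfl fun ν hν => by rw [Finset.mem_erase] at hν; rw [hF, hbxy ν hν.1, hoxy ν hν.1]
  have hz : bump n M v z = (∏ ν ∈ Finset.univ.erase μ, F ν (v ν)) * axisF n (v μ) (blockOf n M z μ) (offsF n M z μ : ℕ) := by
    rw [bump, ← Finset.mul_prod_erase _ _ (Finset.mem_univ μ), mul_comm]
    congr 1
    exact Finset.prod_congr rfl fun ν hν => by rw [Finset.mem_erase] at hν; rw [hF, hbxz ν hν.1, hoxz ν hν.1]
  have hrhs : (∏ ν, if ν = μ then G ν (v ν) else F ν (v ν)) = (∏ ν ∈ Finset.univ.erase μ, F ν (v ν)) * G μ (v μ) := by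
    rw [← Finset.mul_prod_erase _ _ (Finset.mem_univ μ), if_pos rfl, mul_comm]
    congr 1
    exact Finset.prod_congr rfl fun ν hν => by rw [Finset.mem_erase] at hν; rw [if_neg hν.1]
  rw [hx, hy, hz, hrhs, hG]
  rw [show α * ((∏ ν ∈ Finset.univ.erase μ, F ν (v ν)) * axisF n (v μ) (blockOf n M x μ) (offsF n M x μ : ℕ))
      + β * ((∏ ν ∈ Finset.univ.erase μ, F ν (v ν)) * axisF n (v μ) (blockOf n M y μ) (offsF n M y μ : ℕ))
      + γ * ((∏ ν ∈ Finset.univ.erase μ, F ν (v ν)) * axisF n (v μ) (blockOf n M z μ) (offsF n M z μ : ℕ))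
      = (∏ ν ∈ Finset.univ.erase μ, F ν (v ν)) * (α * axisF n (v μ) (blockOf n M x μ) (offsF n M x μ : ℕ)
        + β * axisF n (v μ) (blockOf n M y μ) (offsF n M y μ : ℕ) + γ * axisF n (v μ) (blockOf n M z μ) (offsF n M z μ : ℕ)) by ring,
    abs_mul, abs_of_nonneg hP0]

/-- **FIRST DIFFERENCES**: `Σ_v |bump v (x + e_μ) − bump v x| ≤ 3/(n−1)` for every site `x` and axis `μ` (`2 ≤ n`). [folklore] -/
theorem sum_abs_bump_sub_le (hn : 2 ≤ n) (x : Tor (fine n M)) (μ : Fin d) :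
    ∑ v : Tor M, |bump n M v (x + unitVec (fine n M) μ) - bump n M v x| ≤ 3 * (1 / ((n : ℝ) - 1)) := by
  have hp := pred_pos hn
  set y := x + unitVec (fine n M) μ with hy
  -- blocks/offsets of `y` off the axis agree with those of `x`
  rcases Nat.lt_or_ge ((offsF n M x μ : ℕ) + 1) n with hlt | hge
  · obtain ⟨hb, ho⟩ := blockOf_offsF_add_of_lt n M x μ hlt
    have hcomb := sum_abs_combo_le n M hn μ (-1) 1 0 x y x
      (fun ν _ => by rw [hy, hb]) (fun ν hν => by rw [hy, ho, Function.update_of_ne hν]) (fun _ _ => rfl) (fun _ _ => rfl)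
    simp only [one_mul, neg_one_mul, zero_mul, add_zero, neg_add_eq_sub] at hcomb
    refine hcomb.trans ?_
    rw [hy, hb, ho, Function.update_self]
    simp only [axisF_sub_axisF_same]
    refine (sum_abs_two_ite_le _ _ _ _).trans ?_
    have h1 := rampUp_step_le hn (t := (offsF n M x μ : ℕ)) (by omega)
    have h2 := rampDn_step_le hn (t := (offsF n M x μ : ℕ)) (by omega)
    linarith
  · have heq : (offsF n M x μ : ℕ) + 1 = n := le_antisymm (offsF n M x μ).isLt hge
    obtain ⟨hb, ho⟩ := blockOf_offsF_add_of_eq n M x μ heq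
    have hcomb := sum_abs_combo_le n M hn μ (-1) 1 0 x y x
      (fun ν hν => by rw [hy, hb]; simp [unitVec, hν]) (fun ν hν => by rw [hy, ho, Function.update_of_ne hν])
      (fun _ _ => rfl) (fun _ _ => rfl)
    simp only [one_mul, neg_one_mul, zero_mul, add_zero, neg_add_eq_sub] at hcomb
    refine hcomb.trans ?_
    rw [hy, hb, ho, Function.update_self]
    have hlast : (offsF n M x μ : ℕ) = n - 1 := by omega
    have hν : (blockOf n M x + unitVec M μ) μ = blockOf n M x μ + 1 := by simp [unitVec]
    simp only [Fin.val_zero, hlast, hν, axisF, rampUp_zero, rampDn_zero, rampUp_last hn, rampDn_last hn]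
    -- every term vanishes: `[c = b+2]·0 + [c = b+1]·1 − ([c = b+1]·1 + [c = b]·0) = 0`
    rw [Finset.sum_eq_zero fun c _ => ?_]
    · positivity
    · split_ifs <;> norm_num

omit [NeZero n] hM in
/-- regrouping of the axis combination for a SECOND difference inside one block. [folklore] -/
theorem axisF_second_same {m : ℕ} (c b : ZMod m) (t tp tm : ℕ) :
    2 * axisF n c b t - axisF n c b tp - axisF n c b tm
      = (if c = b + 1 then 2 * rampUp n t - rampUp n tp - rampUp n tm else 0)
        + (if c = b then 2 * rampDn n t - rampDn n tp - rampDn n tm else 0) := by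
  unfold axisF; split_ifs <;> ring

/-- **PURE SECOND DIFFERENCES**: `Σ_v |2·bump v x − bump v (x + e_μ) − bump v (x − e_μ)| ≤ 12/(n−1)²` (`2 ≤ n`). [folklore] -/
theorem sum_abs_bump_second_le (hn : 2 ≤ n) (x : Tor (fine n M)) (μ : Fin d) :
    ∑ v : Tor M, |2 * bump n M v x - bump n M v (x + unitVec (fine n M) μ) - bump n M v (x - unitVec (fine n M) μ)|
      ≤ 12 * (1 / ((n : ℝ) - 1)) ^ 2 := by
  have hp := pred_pos hn
  have hh : 0 ≤ (1 / ((n : ℝ) - 1)) ^ 2 := sq_nonneg _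
  set y := x + unitVec (fine n M) μ with hy
  set w := x - unitVec (fine n M) μ with hw
  -- the three sites agree off the axis `μ`; reduce to the axis sum with coefficients `(2, −1, −1)`
  have hsub := blockOf_offsF_sub n M x μ
  have hoffw : ∀ ν, ν ≠ μ → offsF n M w ν = offsF n M x ν := by
    rcases hsub with h | h
    · exact h.2.2.2
    · exact h.2.2.2
  have hblw : ∀ ν, ν ≠ μ → blockOf n M w ν = blockOf n M x ν := by
    intro ν hν
    rcases hsub with h | h
    · rw [h.2.1]
    · rw [h.2.1]; simp [unitVec, hν]
  rcases Nat.lt_or_ge ((offsF n M x μ : ℕ) + 1) n with hlt | hge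
  · -- `x + e_μ` stays in the block of `x`
    obtain ⟨hb, ho⟩ := blockOf_offsF_add_of_lt n M x μ hlt
    have hcomb := sum_abs_combo_le n M hn μ 2 (-1) (-1) x y w
      (fun ν _ => by rw [hy, hb]) (fun ν hν => by rw [hy, ho, Function.update_of_ne hν]) hblw hoffw
    simp only [neg_one_mul, ← sub_eq_add_neg] at hcomb
    refine hcomb.trans ?_
    rw [hy, hb, ho, Function.update_self]
    rcases hsub with ⟨ht0, hbw, how, -⟩ | ⟨ht0, hbw, how, -⟩
    · -- interior: `1 ≤ t ≤ n − 2`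
      rw [hw, hbw, how]
      simp only [axisF_second_same]
      refine (sum_abs_two_ite_le _ _ _ _).trans ?_
      have h1 := rampUp_second_le hn (t := (offsF n M x μ : ℕ)) (Nat.one_le_iff_ne_zero.mpr ht0) (by omega)
      have h2 := rampDn_second_le hn (t := (offsF n M x μ : ℕ)) (Nat.one_le_iff_ne_zero.mpr ht0) (by omega)
      linarith
    · -- first layer: `t = 0`, `x − e_μ` is the last layer of the block below
      rw [hw, hbw, how]
      simp only [ht0, zero_add]
      have hreg : ∀ c : ZMod (M μ),
          2 * axisF n c (blockOf n M x μ) 0 - axisF n c (blockOf n M x μ) 1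
            - axisF n c ((blockOf n M x - unitVec M μ) μ) (n - 1)
          = (if c = blockOf n M x μ + 1 then -rampUp n 1 else 0) + (if c = blockOf n M x μ then rampUp n 1 else 0) := by
        intro c
        have hμ : (blockOf n M x - unitVec M μ) μ = blockOf n M x μ - 1 := by simp [unitVec]
        rw [hμ]
        unfold axisF
        rw [sub_add_cancel, rampUp_zero, rampDn_zero, rampUp_last hn, rampDn_last hn]
        unfold rampDn
        split_ifs <;> ring
      simp only [hreg]
      refine (sum_abs_two_ite_le _ _ _ _).trans ?_
      have h1 := rampUp_one_le hn
      rw [abs_neg]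
      linarith
  · -- last layer: `t = n − 1`, `x + e_μ` is the first layer of the block above, `x − e_μ` has offset `n − 2`
    have heq : (offsF n M x μ : ℕ) + 1 = n := le_antisymm (offsF n M x μ).isLt hge
    obtain ⟨hb, ho⟩ := blockOf_offsF_add_of_eq n M x μ heq
    have hcomb := sum_abs_combo_le n M hn μ 2 (-1) (-1) x y w
      (fun ν hν => by rw [hy, hb]; simp [unitVec, hν]) (fun ν hν => by rw [hy, ho, Function.update_of_ne hν]) hblw hoffw
    simp only [neg_one_mul, ← sub_eq_add_neg] at hcomb
    refine hcomb.trans ?_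
    rw [hy, hb, ho, Function.update_self]
    rcases hsub with ⟨ht0, hbw, how, -⟩ | ⟨ht0, -, -, -⟩
    · rw [hw, hbw, how]
      have hlast : (offsF n M x μ : ℕ) = n - 1 := by omega
      have hprev : n - 1 - 1 = n - 2 := by omega
      simp only [Fin.val_zero, hlast, hprev]
      have hreg : ∀ c : ZMod (M μ),
          2 * axisF n c (blockOf n M x μ) (n - 1) - axisF n c ((blockOf n M x + unitVec M μ) μ) 0
            - axisF n c (blockOf n M x μ) (n - 2)
          = (if c = blockOf n M x μ + 1 then 1 - rampUp n (n - 2) else 0)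
            + (if c = blockOf n M x μ then -(1 - rampUp n (n - 2)) else 0) := by
        intro c
        have hμ : (blockOf n M x + unitVec M μ) μ = blockOf n M x μ + 1 := by simp [unitVec]
        rw [hμ]
        unfold axisF
        rw [rampUp_zero, rampDn_zero, rampUp_last hn, rampDn_last hn]
        unfold rampDn
        split_ifs <;> ring
      simp only [hreg]
      refine (sum_abs_two_ite_le _ _ _ _).trans ?_
      have h1 := one_sub_rampUp_le hn
      rw [abs_neg]
      linarith
    · exfalso; omega

end Differences

/-! ## §5 Locally monotone block sets and the admissible cutoffs -/

section Monotone

variable (n : ℕ) [NeZero n] (M : Fin d → ℕ) [hM : ∀ μ, NeZero (M μ)]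

/-- [shape] the block `b` lies in the PATCH of the vertex `v` (the `2^d` blocks around the corner `v`). [folklore] -/
def InPatch (v b : Tor M) : Prop := ∀ ν, v ν = b ν + 1 ∨ v ν = b ν

/-- [shape] the patch of `v` is DOWNWARD-CLOSED along `μ` in `S`: every UPPER block of the patch that is in `S` has its lower
neighbour in `S`. [folklore] -/
def DownClosed (S : Tor M → Prop) (v : Tor M) (μ : Fin d) : Prop :=
  ∀ b, InPatch M v b → v μ = b μ → S b → S (b - unitVec M μ)

/-- [shape] the patch of `v` is UPWARD-CLOSED along `μ` in `S`. [folklore] -/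
def UpClosed (S : Tor M → Prop) (v : Tor M) (μ : Fin d) : Prop :=
  ∀ b, InPatch M v b → v μ = b μ + 1 → S b → S (b + unitVec M μ)

/-- [shape] **LOCALLY MONOTONE block set**: every vertex patch is downward- or upward-closed along every axis.  Boxes, slabs, L-shapes,
complements of boxes, Fichera corners are locally monotone; the checkerboard pair and the 4-chain of cubes winding around a vertex are not.
[folklore] -/
def LocallyMonotone (S : Tor M → Prop) : Prop := ∀ v μ, DownClosed M S v μ ∨ UpClosed M S v μ

open Classical in
/-- **THE CUTOFF** `ψ_μ = Σ_{v : patch downward-closed along μ} bump v`. [folklore] -/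
def psi (S : Tor M → Prop) (μ : Fin d) (x : Tor (fine n M)) : ℝ :=
  ∑ v : Tor M, if DownClosed M S v μ then bump n M v x else 0

variable (S : Tor M → Prop)

/-- `0 ≤ ψ ≤ 1`. [folklore] -/
theorem psi_mem (hn : 2 ≤ n) (μ : Fin d) (x : Tor (fine n M)) : 0 ≤ psi n M S μ x ∧ psi n M S μ x ≤ 1 := by
  classical
  unfold psi
  constructor
  · exact Finset.sum_nonneg fun v _ => by split_ifs; exacts [(bump_mem n M hn v x).1, le_rfl]
  · calc (∑ v : Tor M, if DownClosed M S v μ then bump n M v x else 0) ≤ ∑ v : Tor M, bump n M v x :=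
          Finset.sum_le_sum fun v _ => by split_ifs; exacts [le_rfl, (bump_mem n M hn v x).1]
      _ = 1 := sum_bump n M x

/-- an indicator-weighted difference is dominated by the plain one. [folklore] -/
theorem abs_ite_sub_ite_le (P : Prop) [Decidable P] (a b : ℝ) : |(if P then a else 0) - (if P then b else 0)| ≤ |a - b| := by
  split_ifs
  · exact le_rfl
  · rw [sub_zero, abs_zero]; exact abs_nonneg _

/-- first differences of `ψ`: `|ψ(x + e_ν) − ψ(x)| ≤ 3/(n−1)`. [folklore] -/
theorem psi_lip (hn : 2 ≤ n) (μ : Fin d) (x : Tor (fine n M)) (ν : Fin d) :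
    |psi n M S μ (x + unitVec (fine n M) ν) - psi n M S μ x| ≤ 3 * (1 / ((n : ℝ) - 1)) := by
  classical
  unfold psi
  rw [← Finset.sum_sub_distrib]
  refine (Finset.abs_sum_le_sum_abs _ _).trans ((Finset.sum_le_sum fun v _ => abs_ite_sub_ite_le _ _ _).trans ?_)
  exact sum_abs_bump_sub_le n M hn x ν

/-- pure second differences of `ψ`: `|2ψ(x) − ψ(x + e_ν) − ψ(x − e_ν)| ≤ 12/(n−1)²`. [folklore] -/
theorem psi_lip₂ (hn : 2 ≤ n) (μ : Fin d) (x : Tor (fine n M)) (ν : Fin d) :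
    |2 * psi n M S μ x - psi n M S μ (x + unitVec (fine n M) ν) - psi n M S μ (x - unitVec (fine n M) ν)|
      ≤ 12 * (1 / ((n : ℝ) - 1)) ^ 2 := by
  classical
  unfold psi
  rw [Finset.mul_sum, ← Finset.sum_sub_distrib, ← Finset.sum_sub_distrib]
  refine (Finset.abs_sum_le_sum_abs _ _).trans ((Finset.sum_le_sum fun v _ => ?_).trans (sum_abs_bump_second_le n M hn x ν))
  split_ifs
  · exact le_rfl
  · simp

/-- the block of a site of the region is in `S`; a neighbour outside the region lies in another block. [folklore] -/
theorem offsF_eq_zero_of_exit (μ : Fin d) {x : Tor (fine n M)} (hx : blockReg n M S x) (hx' : ¬ blockReg n M S (x - unitVec (fine n M) μ)) :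
    (offsF n M x μ : ℕ) = 0 ∧ ¬ S (blockOf n M x - unitVec M μ) := by
  rcases blockOf_offsF_sub n M x μ with ⟨_, hb, -, -⟩ | ⟨h0, hb, -, -⟩
  · exact absurd (show blockReg n M S (x - unitVec (fine n M) μ) by unfold blockReg; rw [hb]; exact hx) hx'
  · exact ⟨h0, fun h => hx' (show blockReg n M S (x - unitVec (fine n M) μ) by unfold blockReg; rw [hb]; exact h)⟩

/-- … and for the forward neighbour. [folklore] -/
theorem offsF_eq_last_of_exit (μ : Fin d) {x : Tor (fine n M)} (hx : blockReg n M S x) (hx' : ¬ blockReg n M S (x + unitVec (fine n M) μ)) :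
    (offsF n M x μ : ℕ) + 1 = n ∧ ¬ S (blockOf n M x + unitVec M μ) := by
  rcases Nat.lt_or_ge ((offsF n M x μ : ℕ) + 1) n with hlt | hge
  · obtain ⟨hb, -⟩ := blockOf_offsF_add_of_lt n M x μ hlt
    exact absurd (show blockReg n M S (x + unitVec (fine n M) μ) by unfold blockReg; rw [hb]; exact hx) hx'
  · have heq : (offsF n M x μ : ℕ) + 1 = n := le_antisymm (offsF n M x μ).isLt hge
    obtain ⟨hb, -⟩ := blockOf_offsF_add_of_eq n M x μ heq
    exact ⟨heq, fun h => hx' (show blockReg n M S (x + unitVec (fine n M) μ) by unfold blockReg; rw [hb]; exact h)⟩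

/-- a non-vanishing bump puts the block in the patch. [folklore] -/
theorem inPatch_of_bump_ne_zero {v : Tor M} {x : Tor (fine n M)} (h : bump n M v x ≠ 0) : InPatch M v (blockOf n M x) := fun ν => by
  rcases axisF_ne_zero n (axisF_ne_zero_of_bump_ne_zero n M h ν) with ⟨h1, -⟩ | ⟨h2, -⟩
  · exact Or.inl h1
  · exact Or.inr h2

/-- **`ψ = 0` on the sites of the region whose `−μ`-neighbour is outside.** [folklore] -/
theorem psi_eq_zero (μ : Fin d) {x : Tor (fine n M)} (hx : blockReg n M S x)
    (hx' : ¬ blockReg n M S (x - unitVec (fine n M) μ)) : psi n M S μ x = 0 := by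
  classical
  obtain ⟨h0, hS⟩ := offsF_eq_zero_of_exit n M S μ hx hx'
  unfold psi
  refine Finset.sum_eq_zero fun v _ => ?_
  split_ifs with hD
  · by_contra hb
    have hP := inPatch_of_bump_ne_zero n M hb
    rcases axisF_ne_zero n (axisF_ne_zero_of_bump_ne_zero n M hb μ) with ⟨-, hu⟩ | ⟨h2, -⟩
    · rw [h0, rampUp_zero] at hu; exact hu rfl
    · exact hS (hD _ hP h2 hx)
  · rfl

/-- **`ψ = 1` on the sites of the region whose `+μ`-neighbour is outside** (this is where local monotonicity enters). [folklore] -/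
theorem psi_eq_one (hn : 2 ≤ n) (hmono : LocallyMonotone M S) (μ : Fin d) {x : Tor (fine n M)} (hx : blockReg n M S x)
    (hx' : ¬ blockReg n M S (x + unitVec (fine n M) μ)) : psi n M S μ x = 1 := by
  classical
  obtain ⟨hlast, hS⟩ := offsF_eq_last_of_exit n M S μ hx hx'
  have ht : (offsF n M x μ : ℕ) = n - 1 := by omega
  unfold psi
  rw [← sum_bump n M x]
  refine Finset.sum_congr rfl fun v _ => ?_
  split_ifs with hD
  · rfl
  · by_contra hb
    have hb' : bump n M v x ≠ 0 := fun h => hb h.symm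
    have hP := inPatch_of_bump_ne_zero n M hb'
    rcases axisF_ne_zero n (axisF_ne_zero_of_bump_ne_zero n M hb' μ) with ⟨h1, -⟩ | ⟨-, hd'⟩
    · rcases hmono v μ with hD' | hU
      · exact hD hD'
      · exact hS (hU _ hP h1 hx)
    · rw [ht, rampDn_last hn] at hd'; exact hd' rfl

/-- **THE END OF MODULE (II)**: on a LOCALLY MONOTONE block set, every axis carries an admissible cutoff for the block region, with
`ℓ₁ = 3/(n−1)`, `ℓ₂ = 12/(n−1)²` (`2 ≤ n`). [folklore] -/
theorem admissibleCutoff_psi (hn : 2 ≤ n) [DecidablePred S] (hmono : LocallyMonotone M S) (μ : Fin d) :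
    AdmissibleCutoff (fine n M) (blockReg n M S) μ (psi n M S μ) (3 * (1 / ((n : ℝ) - 1))) (12 * (1 / ((n : ℝ) - 1)) ^ 2) where
  nonneg x := (psi_mem n M S hn μ x).1
  le_one x := (psi_mem n M S hn μ x).2
  lip x ν := psi_lip n M S hn μ x ν
  lip₂ x ν := psi_lip₂ n M S hn μ x ν
  zero_of _ hx hx' := psi_eq_zero n M S μ hx hx'
  one_of _ hx hx' := psi_eq_one n M S hn hmono μ hx hx'

/-- **the unit-scale form module (III) consumes**: `ℓ₁ = 6/n`, `ℓ₂ = 48/n²`. [folklore] -/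
theorem exists_admissibleCutoff (hn : 2 ≤ n) [DecidablePred S] (hmono : LocallyMonotone M S) (μ : Fin d) :
    ∃ ψ : Tor (fine n M) → ℝ, AdmissibleCutoff (fine n M) (blockReg n M S) μ ψ (6 / (n : ℝ)) (48 / (n : ℝ) ^ 2) := by
  refine ⟨psi n M S μ, (admissibleCutoff_psi n M S hn hmono μ).mono ?_ ?_⟩
  · have hp := pred_pos hn
    have h2 : (2 : ℝ) ≤ n := by exact_mod_cast hn
    rw [mul_one_div, div_le_div_iff₀ hp (by linarith)]
    nlinarith
  · have hp := pred_pos hn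
    have h2 : (2 : ℝ) ≤ n := by exact_mod_cast hn
    have hn0 : (0 : ℝ) < (n : ℝ) ^ 2 := by positivity
    rw [one_div, inv_pow, ← div_eq_mul_inv, div_le_div_iff₀ (pow_pos hp 2) hn0]
    nlinarith [mul_pos hp hp]

end Monotone

end Summit.QuantumFields.BalabanUV.T4Continuum.DirichletMonotoneCutoff

end
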